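import Summits.Ventures.PercRepro.DecisionTreeHK

/-!
# The decision-tree Harris–Kleitman inequality for decreasing events

The twin of `DecisionTreeHK.lean` for two DECREASING events `A`, `B`: `DTree.hk_lower` —
`P(ω ∈ A ∧ ω →_S ω' ∈ B) ≥ P(A) · P(B)` for the edge set `S` built by any proper decision tree.
Same induction (`DTree.hk_aux_lower`); the three monotonicity facts reverse (Harris for two
lower sets via typer-2's `harris_lower`, `prob_anti_of_isLowerSet` on the `A`-side, the
`B`-side bit function decreasing) and the two-point Chebyshev inequality is used in its
decreasing form (`chebyshev_two_point'`).  Needed for Gladkov's Corollary 5.3 (`a|b|c`, `a|bc`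
are decreasing events).
-/

namespace PercRepro

open Finset

variable {E : Type*} [DecidableEq E] [Fintype E]

/-- The two-point Chebyshev inequality for two DECREASING pairs. -/
theorem chebyshev_two_point' {c x₀ x₁ y₀ y₁ : ℝ} (hc0 : 0 ≤ c) (hc1 : c ≤ 1) (hx : x₁ ≤ x₀)
    (hy : y₁ ≤ y₀) :
    (c * x₁ + (1 - c) * x₀) * (c * y₁ + (1 - c) * y₀) ≤ c * (x₁ * y₁) + (1 - c) * (x₀ * y₀) := by
  nlinarith [mul_nonneg (mul_nonneg hc0 (sub_nonneg.mpr hc1)) (mul_nonneg (sub_nonneg.mpr hx) (sub_nonneg.mpr hy))]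

/-- **Harris for the two copies, decreasing events**. -/
theorem expectPair_harris_mix_lower {p₁ p₂ : E → ℝ} (hp₁ : IsProb p₁) (hp₂ : IsProb p₂)
    {A B : Set (Config E)} (hA : IsLowerSet A) (hB : IsLowerSet B) (S : Set E) :
    prob p₁ A * expectPair p₁ p₂ (fun ω ω' => B.indicator 1 (mix S ω ω')) ≤
      expectPair p₁ p₂ (fun ω ω' => A.indicator 1 ω * B.indicator 1 (mix S ω ω')) := by
  set A' : Set (Config (E ⊕ E)) := {Ω | Ω ∘ Sum.inl ∈ A} with hA'
  set B' : Set (Config (E ⊕ E)) := {Ω | mix S (Ω ∘ Sum.inl) (Ω ∘ Sum.inr) ∈ B} with hB'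
  have hA'lo : IsLowerSet A' := fun Ω Ω' h hΩ => hA (fun e => h (Sum.inl e)) hΩ
  have hB'lo : IsLowerSet B' := fun Ω Ω' h hΩ =>
    hB (mix_mono S (fun e => h (Sum.inl e)) (fun e => h (Sum.inr e))) hΩ
  have h := harris_lower (isProb_sum_elim hp₁ hp₂) hA'lo hB'lo
  rw [prob_left, prob_sum_elim_eq_expectPair, prob_sum_elim_eq_expectPair] at h
  have e1 : ∀ α β : Config E, B'.indicator (1 : Config (E ⊕ E) → ℝ) (Sum.elim α β) =
      B.indicator 1 (mix S α β) := by
    intro α β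
    by_cases hb : mix S α β ∈ B
    · have : Sum.elim α β ∈ B' := hb
      rw [Set.indicator_of_mem this, Set.indicator_of_mem hb]; rfl
    · have : Sum.elim α β ∉ B' := hb
      rw [Set.indicator_of_notMem this, Set.indicator_of_notMem hb]
  have e2 : ∀ α β : Config E, (A' ∩ B').indicator (1 : Config (E ⊕ E) → ℝ) (Sum.elim α β) =
      A.indicator 1 α * B.indicator 1 (mix S α β) := by
    intro α β
    by_cases ha : α ∈ A <;> by_cases hb : mix S α β ∈ B
    · have : Sum.elim α β ∈ A' ∩ B' := ⟨ha, hb⟩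
      rw [Set.indicator_of_mem this, Set.indicator_of_mem ha, Set.indicator_of_mem hb]; simp
    · have : Sum.elim α β ∉ A' ∩ B' := fun h' => hb h'.2
      rw [Set.indicator_of_notMem this, Set.indicator_of_notMem hb, mul_zero]
    · have : Sum.elim α β ∉ A' ∩ B' := fun h' => ha h'.1
      rw [Set.indicator_of_notMem this, Set.indicator_of_notMem ha, zero_mul]
    · have : Sum.elim α β ∉ A' ∩ B' := fun h' => ha h'.1
      rw [Set.indicator_of_notMem this, Set.indicator_of_notMem ha, zero_mul]
  simp only [e1, e2] at h
  exact h

/-- The decreasing twin of `DTree.hk_aux`: for a tree proper with respect to the queried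
set `Q`, two weight vectors agreeing off `Q`, a set `S₀ ⊆ Q` of edges already sent to `S` and
increasing `A`, `B`:
`P(A) · E[1_B(ω →_{S₀} ω')] ≤ E[1_A(ω) · 1_B(ω →_{S₀ ∪ S} ω')]`, `S = run t ω ω'`. -/
theorem DTree.hk_aux_lower (t : DTree E) : ∀ (Q S₀ : Set E) (p₁ p₂ : E → ℝ), Proper t Q →
    IsProb p₁ → IsProb p₂ → (∀ e, e ∉ Q → p₁ e = p₂ e) → S₀ ⊆ Q →
    ∀ {A B : Set (Config E)}, IsLowerSet A → IsLowerSet B →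
      prob p₁ A * expectPair p₁ p₂ (fun ω ω' => B.indicator 1 (mix S₀ ω ω')) ≤
        expectPair p₁ p₂ (fun ω ω' => A.indicator 1 ω * B.indicator 1 (mix (S₀ ∪ run t ω ω') ω ω')) := by
  induction t with
  | leaf =>
    intro Q S₀ p₁ p₂ _ hp₁ hp₂ _ _ A B hA hB
    simp only [DTree.run, Set.union_empty]
    exact expectPair_harris_mix_lower hp₁ hp₂ hA hB S₀
  | node e toS next ih =>
    intro Q S₀ p₁ p₂ ht hp₁ hp₂ hoff hS₀ A B hA hB
    obtain ⟨heQ, hnext⟩ := ht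
    have heS₀ : e ∉ S₀ := fun h => heQ (hS₀ h)
    have hce : p₁ e = p₂ e := hoff e heQ
    -- the functions `n b = E[1_B(update (ω →_{S₀} ω') e b)]`, the same under every fixing
    set n : Bool → ℝ := fun x =>
      expectPair p₁ p₂ (fun ω ω' => B.indicator 1 (Function.update (mix S₀ ω ω') e x)) with hn
    have hinv : ∀ (x b b' : Bool),
        expectPair (upd p₁ e b) (upd p₂ e b')
          (fun ω ω' => B.indicator 1 (Function.update (mix S₀ ω ω') e x)) = n x := by
      intro x b b'
      have h1 : ∀ (ω ω' : Config E) (y : Bool),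
          B.indicator (1 : Config E → ℝ) (Function.update (mix S₀ (Function.update ω e y) ω') e x) =
            B.indicator 1 (Function.update (mix S₀ ω ω') e x) := by
        intro ω ω' y; rw [update_mix_update_left]
      have h2 : ∀ (ω ω' : Config E) (y : Bool),
          B.indicator (1 : Config E → ℝ) (Function.update (mix S₀ ω (Function.update ω' e y)) e x) =
            B.indicator 1 (Function.update (mix S₀ ω ω') e x) := by
        intro ω ω' y; rw [update_mix_update_right]
      rw [hn]
      simp only
      rw [expectPair_split p₁ p₂ e]
      -- every term equals the (b, b')-term
      have hc : ∀ (c c' : Bool), expectPair (upd p₁ e c) (upd p₂ e c')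
          (fun ω ω' => B.indicator 1 (Function.update (mix S₀ ω ω') e x)) =
          expectPair (upd p₁ e b) (upd p₂ e b')
            (fun ω ω' => B.indicator 1 (Function.update (mix S₀ ω ω') e x)) :=
        fun c c' => expectPair_upd_eq h1 h2 c c' b b'
      simp only [hc, ← Finset.sum_mul, ← Finset.mul_sum, sum_cf, one_mul]
    have hnmono : n true ≤ n false := by
      rw [hn]
      refine expectPair_mono hp₁ hp₂ fun ω ω' => ?_
      have hle : Function.update (mix S₀ ω ω') e false ≤ Function.update (mix S₀ ω ω') e true := by
        intro e'
        by_cases h : e' = e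
        · subst h; simp
        · simp [Function.update_of_ne h]
      by_cases h1 : Function.update (mix S₀ ω ω') e true ∈ B
      · rw [Set.indicator_of_mem h1, Set.indicator_of_mem (hB hle h1)]
        exact le_rfl
      · rw [Set.indicator_of_notMem h1]
        exact Set.indicator_nonneg (fun _ _ => zero_le_one) _
    -- the A-side: `x b = P_{p₁[e:=b]}(A)`
    have hxmono : prob (upd p₁ e true) A ≤ prob (upd p₁ e false) A := by
      rw [upd_false, upd_true]
      refine prob_anti_of_isLowerSet (hp₁.update e ⟨le_refl (0 : ℝ), zero_le_one⟩)
        (hp₁.update e ⟨zero_le_one, le_refl (1 : ℝ)⟩) (fun e' => ?_) hA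
      by_cases h : e' = e
      · subst h; simp
      · simp [Function.update_of_ne h]
    -- right-hand side after splitting
    have hR : expectPair p₁ p₂ (fun ω ω' => B.indicator 1 (mix S₀ ω ω')) =
        ∑ b' : Bool, cf p₂ e b' * n b' := by
      rw [expectPair_split p₁ p₂ e]
      have key : ∀ b b' : Bool, expectPair (upd p₁ e b) (upd p₂ e b')
          (fun ω ω' => B.indicator 1 (mix S₀ ω ω')) = n b' := by
        intro b b'
        rw [← hinv b' b b']
        refine expectPair_congr fun ω ω' _ h2 => ?_
        have : ω' e = b' := eq_of_weight_upd_ne_zero h2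
        congr 1
        funext e'
        by_cases h : e' = e
        · subst h; rw [Function.update_self, mix_apply_of_notMem heS₀, this]
        · rw [Function.update_of_ne h]
      simp only [key]
      rw [Finset.sum_comm]
      simp only [← Finset.sum_mul, sum_cf, one_mul]
    -- left-hand side after splitting, with the induction hypothesis in each cell
    have hL : ∀ b b' : Bool,
        prob (upd p₁ e b) A * n (if toS then b else b') ≤
          expectPair (upd p₁ e b) (upd p₂ e b')
            (fun ω ω' => A.indicator 1 ω *
              B.indicator 1 (mix (S₀ ∪ DTree.run (DTree.node e toS next) ω ω') ω ω')) := by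
      intro b b'
      set S₀' : Set E := S₀ ∪ (if toS then {e} else ∅) with hS₀'
      have hS₀'Q : S₀' ⊆ insert e Q := by
        rw [hS₀']
        refine Set.union_subset (hS₀.trans (Set.subset_insert e Q)) ?_
        split_ifs
        · exact Set.singleton_subset_iff.mpr (Set.mem_insert e Q)
        · exact Set.empty_subset _
      have hoff' : ∀ e', e' ∉ insert e Q → upd p₁ e b e' = upd p₂ e b' e' := by
        intro e' he'
        have hne : e' ≠ e := fun h => he' (h ▸ Set.mem_insert e Q)
        have he'Q : e' ∉ Q := fun h => he' (Set.mem_insert_of_mem _ h)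
        simp only [upd, Function.update_of_ne hne]
        exact hoff e' he'Q
      have hih := ih b b' (insert e Q) S₀' (upd p₁ e b) (upd p₂ e b') (hnext b b')
        (isProb_upd hp₁ e b) (isProb_upd hp₂ e b') hoff' hS₀'Q hA hB
      -- the B-factor of the induction hypothesis is `n (if toS then b else b')`
      have hBfac : expectPair (upd p₁ e b) (upd p₂ e b') (fun ω ω' => B.indicator 1 (mix S₀' ω ω')) =
          n (if toS then b else b') := by
        rw [← hinv (if toS then b else b') b b']
        refine expectPair_congr fun ω ω' h1 h2 => ?_
        have hω : ω e = b := eq_of_weight_upd_ne_zero h1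
        have hω' : ω' e = b' := eq_of_weight_upd_ne_zero h2
        congr 1
        cases toS with
        | true =>
          simp only [hS₀', if_true, Set.union_singleton, mix_insert, hω]
        | false =>
          simp only [hS₀', Bool.false_eq_true, if_false, Set.union_empty]
          funext e'
          by_cases h : e' = e
          · subst h; rw [Function.update_self, mix_apply_of_notMem heS₀, hω']
          · rw [Function.update_of_ne h]
      rw [← hBfac]
      refine hih.trans (le_of_eq ?_)
      refine expectPair_congr fun ω ω' h1 h2 => ?_
      have hω : ω e = b := eq_of_weight_upd_ne_zero h1
      have hω' : ω' e = b' := eq_of_weight_upd_ne_zero h2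
      simp only [DTree.run, hω, hω', hS₀', Set.union_assoc]
    -- assemble
    rw [hR, prob_eq_sum_cf p₁ e A, expectPair_split p₁ p₂ e]
    have hterm : ∀ b b' : Bool, cf p₁ e b * cf p₂ e b' * (prob (upd p₁ e b) A * n (if toS then b else b')) ≤
        cf p₁ e b * cf p₂ e b' * expectPair (upd p₁ e b) (upd p₂ e b')
          (fun ω ω' => A.indicator 1 ω *
            B.indicator 1 (mix (S₀ ∪ DTree.run (DTree.node e toS next) ω ω') ω ω')) := by
      intro b b'
      have hc : 0 ≤ cf p₁ e b * cf p₂ e b' := by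
        unfold cf
        split_ifs <;> nlinarith [hp₁.nonneg e, hp₁.le_one e, hp₂.nonneg e, hp₂.le_one e]
      exact mul_le_mul_of_nonneg_left (hL b b') hc
    refine le_trans ?_ (Finset.sum_le_sum fun b _ => Finset.sum_le_sum fun b' _ => hterm b b')
    simp only [Fintype.sum_bool, cf, if_true, Bool.false_eq_true, if_false]
    rw [← hce]
    have hc0 := hp₁.nonneg e
    have hc1 := hp₁.le_one e
    cases toS with
    | true =>
      simp only [if_true]
      have := chebyshev_two_point' hc0 hc1 hxmono hnmono
      nlinarith [this]
    | false =>
      simp only [Bool.false_eq_true, if_false]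
      nlinarith

/-- **Gladkov's Theorem 3.2 for decreasing events**: for a proper decision tree `t` and
decreasing events `A`, `B`, `P(ω ∈ A ∧ ω →_S ω' ∈ B) ≥ P(A) · P(B)`. -/
theorem DTree.hk_lower {p : E → ℝ} (hp : IsProb p) {t : DTree E} (ht : Proper t ∅)
    {A B : Set (Config E)} (hA : IsLowerSet A) (hB : IsLowerSet B) :
    prob p A * prob p B ≤
      ∑ ω, ∑ ω', weight p ω * weight p ω' *
        (A.indicator 1 ω * B.indicator 1 (mix (run t ω ω') ω ω')) := by
  have h := DTree.hk_aux_lower t ∅ ∅ p p ht hp hp (fun _ _ => rfl) (Set.Subset.refl _) hA hB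
  simp only [mix_empty, Set.empty_union] at h
  have hB' : expectPair p p (fun _ ω' => B.indicator 1 ω') = prob p B := by
    unfold expectPair prob
    have : ∀ ω : Config E, ∑ ω', weight p ω * weight p ω' * B.indicator 1 ω' =
        weight p ω * ∑ ω', B.indicator (weight p) ω' := by
      intro ω
      rw [Finset.mul_sum]
      refine Finset.sum_congr rfl fun ω' _ => ?_
      by_cases h : ω' ∈ B <;> simp [h]
    simp only [this, ← Finset.sum_mul, sum_weight, one_mul]
  rw [hB'] at h
  exact h

end PercRepro
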